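/-
Copyright (c) 2026 the pub-hodgecm-mathlib formalisation cell (harness21).  Prover seat hodgecm-mathlib-K2E1-p16 (g2), Track B «K2-LIT» ENGINE E1, h413 = `stmt-HodgeConjecture-24833`,
route `HCCMUnconditional`, R90-S8 «ContSpec-n½» #2∕#3 chain, deal S8-R156 (2) (S8 dealer R90-CS-plan (g3)): (L2) PAYER PART 2a — the CONTINUED scalars `wc, Bc` of ★ p863403 as
finite sums of continued coordinates: holomorphy on the domains and agreement with the literal pairings on the tube, BY NAME.
-/
import Summits.HodgeConjecture.HodgeConjecture.Theorems.K2E1ChiScatteringPairingsTubeCMThree    -- ★ p863497 (this seat): part 1 — pairings ∕ kernel = finite sums of coordinates on the tube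
import HarnessLib

/-!
# h413 ∕ R90-S8 (L2) part 2a — `K2E1ChiScatteringPairingsContinuedCMThree`: THE CONTINUED SCALARS `wc, Bc` OF ★ p863403 FROM CONTINUED COORDINATES — HOLOMORPHY AND TUBE AGREEMENT

Cell `pub/hodgecm-mathlib`, crux H413 = `stmt-HodgeConjecture-24833`; S8 dealer R90-CS-plan (g3) S8-R156 (2).  THEOREMS ONLY (no `def`, no `instance`, no notation, no named-fact
hypothesis, no `sorry`); lane `--supports stmt-HodgeConjecture-24833 --as helper` (count-neutral).  PURE bookkeeping: a measure space `(X, μ)` (consumer: `K_U, μ_K`), a second one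
`(Y, ν)` with a set `S_I` and two weights `nrm, η : Y → ℂ` (consumer: the ideles, `{‖x‖ ≤ 1} ∩ 𝓕_I`, `‖x‖`, `χ₁ʷ·conj χ₁`), a finite family `b_j : X → ℂ`, a family `Φ : ℂ → X → ℂ`
(consumer: the intertwined coefficient `φ̃_z`), TUBE coordinates `q_j` with `Σ_j q_j(z)•b_j = Φ z` on `S` (★ p862274, `ν 𝓕 = 1`), and CONTINUED coordinates `qc_j` holomorphic on an open `D`
agreeing with `q_j` on `S`.

THE MATHEMATICS ([BernsteinLapid2019, §4 p. 10, §7]; [MoeglinWaldspurger1995, IV.1.9–IV.1.11, IV.2.3]).  The composition ★ p863403 `msBound_middlePole_of_tube_letters` asks for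
continued scalars `wc : ℂ → ℂ`, `Bc : ℂ → ℂ → ℂ` with (L2): `wc` holomorphic on the quarter-plane domains, `Bc` holomorphic in the first and anti-holomorphic in the second variable there,
and AGREEMENT on the tube `{2 < Re}` with the literal scalars of ★ (ii): `w s = ∫_{S_I} ‖x‖·(η(x)·∫_K φ̃_s conj φ)`, `B s s′ = κ·∫_K φ̃_s conj φ̃_{s′}`.  With the scattering coordinates these
literal pairings are finite sums (★ p863497); so DEFINE-FREE candidates are
`wc s := ∫_{S_I} nrm·(η·Σ_j qc_j(s)·G_j)`, `G_j = ∫ b_j conj ψ`, and `Bc s s′ := κ·Σ_{j,l} qc_j(s)·conj qc_l(s′)·G_{jl}`, `G_{jl} = ∫ b_j conj b_l`: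
* §1 **`wc_eq_mul_bracket`** (the constant leaves the bracket), **`differentiableOn_wc`** — (L2) `hwc₁∕hwc₂` at `D := D₁, D₂`;
* §2 **`wc_agree`** — (L2) `hwagree` on `S`: `qc_j = q_j` there and ★ `pairing_eq_sum_coords`;
* §3 **`differentiableOn_Bc_fst`**, **`differentiableOn_Bc_snd_conj`** (Schwarz reflection ★ `differentiableOn_conj_comp_conj`) — (L2) `hBc₁ hBc₂` (`hBc₁′ hBc₂′`);
* §4 **`Bc_agree`** — (L2) `hBagree` on `S × S` by ★ `kernel_eq_sum_coords`.
So (L2) of ★ p863403 is DISCHARGED BY NAME modulo the ONE letter «continued coordinates `qc_j` holomorphic on `D ⊇` the quarter-plane domains, `= q_j` on the tube» (part 2b: Euler route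
`qc_j = qc·r_j` through the continued Hecke-`L` quotient × normalised local intertwiners, or the X-system∕[BernsteinLapid2019] ball packages ★ rows 8∕10 of this seat — census next).
HONEST LABEL: HC_CM is proved only modulo the 7 printed citations (2 remaining named inputs: hLiu418 = `stmt-HodgeConjecture-24832`, h413 = `stmt-HodgeConjecture-24833`) until rung 0
closes; this file asserts no named fact and closes no socket; count-neutral.

## References
* [BernsteinLapid2019] J. Bernstein, E. Lapid, *On the meromorphic continuation of Eisenstein series*, J. AMS 37 (2024), §4 p. 10, §7.
* [MoeglinWaldspurger1995] C. Mœglin, J.-L. Waldspurger, *Spectral decomposition and Eisenstein series* (1995), IV.1.9–IV.1.11, IV.2.3.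
-/

set_option autoImplicit false
-- the mandated namespace repeats `HodgeConjecture.HodgeConjecture`, as in every `Theorems/*.lean` of this sub-problem
set_option linter.dupNamespace false

noncomputable section

open MeasureTheory Measure Set
open scoped ComplexConjugate
open Summit.HodgeConjecture.HodgeConjecture.Cruxes.H413.K2E1MaassSelbergContinuedCMTwo (differentiableOn_conj_comp_conj)
open Summit.HodgeConjecture.HodgeConjecture.Cruxes.H413.K2E1ChiScatteringPairingsTubeCMThree (pairing_eq_sum_coords kernel_eq_sum_coords)

namespace Summit.HodgeConjecture.HodgeConjecture.Cruxes.H413.K2E1ChiScatteringPairingsContinuedCMThree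

variable {X : Type*} [MeasurableSpace X] (μ : Measure X)
variable {Y : Type*} [MeasurableSpace Y] (ν : Measure Y) (SI : Set Y) (nrm η : Y → ℂ)
variable {ι : Type} [Fintype ι] {b : ι → X → ℂ} {q qc : ι → ℂ → ℂ} {Φ : ℂ → X → ℂ} {S D : Set ℂ}

/-! ## §1 The continued first scalar `wc`: the constant leaves the bracket; holomorphy on `D` -/

omit [MeasurableSpace X] in
/-- **`wc s = (Σ_j qc_j(s)·G_j)·∫_{S_I} nrm·η`** — the `s`-dependent constant leaves the idelic bracket (twin of ★ `bracket_cross_eq`). [cite: MoeglinWaldspurger1995, IV.2.3] -/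
theorem wc_eq_mul_bracket (G : ι → ℂ) (s : ℂ) :
    (∫ y in SI, nrm y * (η y * ∑ j, qc j s * G j) ∂ν) = (∑ j, qc j s * G j) * ∫ y in SI, nrm y * η y ∂ν := by
  rw [← integral_const_mul]
  refine integral_congr_ae (Filter.Eventually.of_forall fun y => ?_)
  ring

/-- **`wc` IS HOLOMORPHIC ON `D`** (shape `hwc₁`∕`hwc₂` of ★ p863403 at `D := D₁, D₂`): `wc s = ∫_{S_I} nrm·(η·Σ_j qc_j(s)·∫ b_j conj ψ dμ) dν` with `qc_j` holomorphic on `D`.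
[cite: BernsteinLapid2019, §4 p. 10] -/
theorem differentiableOn_wc (hqcd : ∀ j, DifferentiableOn ℂ (qc j) D) (ψ : X → ℂ) :
    DifferentiableOn ℂ (fun s : ℂ => ∫ y in SI, nrm y * (η y * ∑ j, qc j s * ∫ x, b j x * conj (ψ x) ∂μ) ∂ν) D := by
  have h : DifferentiableOn ℂ (fun s : ℂ => (∑ j, qc j s * ∫ x, b j x * conj (ψ x) ∂μ) * ∫ y in SI, nrm y * η y ∂ν) D :=
    (DifferentiableOn.fun_sum fun j _ => (hqcd j).mul_const _).mul_const _
  exact h.congr fun s _ => wc_eq_mul_bracket ν SI nrm η (fun j => ∫ x, b j x * conj (ψ x) ∂μ) s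

/-! ## §2 Agreement of `wc` with the literal first scalar on the tube set `S` -/

/-- **`wc = w` ON `S`** (shape `hwagree` of ★ p863403): on `S` the continued coordinates are the tube coordinates (`hqagree`) and `Σ_j q_j(s)·∫ b_j conj ψ = ∫ Φ_s conj ψ`
(★ `pairing_eq_sum_coords`). [cite: BernsteinLapid2019, §4 p. 10] [cite: MoeglinWaldspurger1995, IV.2.3] -/
theorem wc_agree (hq : ∀ z ∈ S, (∑ j, q j z • b j) = Φ z) (hqagree : ∀ j, ∀ z ∈ S, qc j z = q j z)
    {ψ : X → ℂ} (hint : ∀ j, Integrable (fun x => b j x * conj (ψ x)) μ) {s : ℂ} (hs : s ∈ S) :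
    (∫ y in SI, nrm y * (η y * ∑ j, qc j s * ∫ x, b j x * conj (ψ x) ∂μ) ∂ν) = ∫ y in SI, nrm y * (η y * ∫ x, Φ s x * conj (ψ x) ∂μ) ∂ν := by
  have hsum : (∑ j, qc j s * ∫ x, b j x * conj (ψ x) ∂μ) = ∫ x, Φ s x * conj (ψ x) ∂μ := by
    rw [pairing_eq_sum_coords μ hq hint hs]
    exact Finset.sum_congr rfl fun j _ => by rw [hqagree j s hs]
  rw [hsum]

/-! ## §3 The continued kernel `Bc`: separate holomorphy -/

omit [MeasurableSpace X] in
/-- **`s ↦ Bc s s′` IS HOLOMORPHIC ON `D`** for every `s′` (shape `hBc₁`∕`hBc₁′` of ★ p863403): `Bc s s′ = κ·Σ_{j,l} qc_j(s)·conj qc_l(s′)·G_{jl}`.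
[cite: BernsteinLapid2019, §4 p. 10] -/
theorem differentiableOn_Bc_fst (hqcd : ∀ j, DifferentiableOn ℂ (qc j) D) (κ : ℂ) (G : ι → ι → ℂ) (s' : ℂ) :
    DifferentiableOn ℂ (fun s : ℂ => κ * ∑ j, ∑ l, qc j s * conj (qc l s') * G j l) D :=
  (DifferentiableOn.fun_sum fun j _ => DifferentiableOn.fun_sum fun _ _ => ((hqcd j).mul_const _).mul_const _).const_mul κ

omit [MeasurableSpace X] in
/-- **`u ↦ Bc s (conj u)` IS HOLOMORPHIC ON `conj⁻¹ D`** for every `s` (`D` open; shape `hBc₂`∕`hBc₂′` of ★ p863403): the factor `conj (qc_l (conj u))` is holomorphic by Schwarz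
reflection (★ `differentiableOn_conj_comp_conj`). [cite: BernsteinLapid2019, §4 p. 10] -/
theorem differentiableOn_Bc_snd_conj (hD : IsOpen D) (hqcd : ∀ j, DifferentiableOn ℂ (qc j) D) (κ : ℂ) (G : ι → ι → ℂ) (s : ℂ) :
    DifferentiableOn ℂ (fun u : ℂ => κ * ∑ j, ∑ l, qc j s * conj (qc l (conj u)) * G j l) {u : ℂ | conj u ∈ D} :=
  (DifferentiableOn.fun_sum fun _ _ => DifferentiableOn.fun_sum fun l _ =>
    (((differentiableOn_conj_comp_conj hD (hqcd l)).const_mul _).mul_const _)).const_mul κ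

/-! ## §4 Agreement of `Bc` with the literal kernel on `S × S` -/

/-- **`Bc = B` ON `S × S`** (shape `hBagree` of ★ p863403): `κ·Σ_{j,l} qc_j(s) conj qc_l(s′) G_{jl} = κ·∫ Φ_s conj Φ_{s′} dμ` for `s, s′ ∈ S` (`hqagree` + ★ `kernel_eq_sum_coords`).
[cite: BernsteinLapid2019, §4 p. 10] [cite: MoeglinWaldspurger1995, IV.2.3] -/
theorem Bc_agree (hq : ∀ z ∈ S, (∑ j, q j z • b j) = Φ z) (hqagree : ∀ j, ∀ z ∈ S, qc j z = q j z)
    (hbb : ∀ j l, Integrable (fun x => b j x * conj (b l x)) μ) (κ : ℂ) {s s' : ℂ} (hs : s ∈ S) (hs' : s' ∈ S) :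
    κ * ∑ j, ∑ l, qc j s * conj (qc l s') * ∫ x, b j x * conj (b l x) ∂μ = κ * ∫ x, Φ s x * conj (Φ s' x) ∂μ := by
  rw [kernel_eq_sum_coords μ hq hbb hs hs']
  congr 1
  refine Finset.sum_congr rfl fun j _ => Finset.sum_congr rfl fun l _ => ?_
  rw [hqagree j s hs, hqagree l s' hs']

end Summit.HodgeConjecture.HodgeConjecture.Cruxes.H413.K2E1ChiScatteringPairingsContinuedCMThree

end
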